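import Summits.QuantumAdvantage.QuantumAdvantage.Theorems.CubicForrelationNearExactIsExactRothausB

/-!
# Crux `CubicForrelation.NearExactIsExact` (stmt-QuantumAdvantage-14043), line `direct-sum-amplification` —
stub LB2: the bent level of the 2-adic Walsh tower (`stub_levelBent`)

In the tree's `Bool` / `IsDegLeFun` / `W` vocabulary (`W_g(x) = Σ_y (−1)^{g(y)} (−1)^{y·x}`, the unnormalised Walsh
transform of `(−1)^g`). On `m + m` bits: if `W_g(x) = 2^m · u(x)` with `u(x) ∈ ℤ` for every `x`, and the parity
function `x ↦ [u(x) odd]` has algebraic degree `≤ d`, then EITHER `g` is bent (`W_g(x)² = 2^{m+m}` for all `x`)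
OR `Σ_x |W_g(x)| ≤ 2^{3m} · (1 − (1/2)^{d+1})`. No hypothesis on the degree of `g` is needed.

Proof. Parseval (`sum_W_sq`: `Σ_x W_g(x)² = 2^{m+m} · 2^{m+m}`) gives `Σ_x u(x)² = 2^{m+m}`, the number of points.
If every `u(x)` is odd then every `u(x)² ≥ 1`, so every `u(x)² = 1`: bent. Otherwise the negated parity
`x ↦ [u(x) even]` is a non-zero Boolean function of degree `≤ d` (xor with the constant `true`,
`bb_isDegLeFun_bxor`), so `#{x : u(x) even} ≥ 2^{m+m−d}` by the Reed–Muller minimum weight (`bb_rmWeight_holds`),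
i.e. `#{x : u(x) odd} ≤ 2^{m+m} − 2^{m+m−d}`. Pointwise `2|u| ≤ u² + [u odd]` (`lb_pointwise`: for even `u`,
`|u| − 1` is odd, hence non-zero, so `(|u| − 1)² ≥ 1`); summing, `2 Σ_x |u(x)| ≤ 2^{m+m} + 2^{m+m} − 2^{m+m−d}`, and
`Σ_x |W_g(x)| = 2^m Σ_x |u(x)|` closes the bound.

Sources: O. S. Rothaus, *On "bent" functions*, JCTA 20 (1976) (the 2-adic normalisation of Walsh spectra, bentness);
F. J. MacWilliams, N. J. A. Sloane, *The Theory of Error-Correcting Codes*, Ch. 13 §3 (RM minimum weight, here the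
landed `bb_rmWeight_holds`); R. O'Donnell, *Analysis of Boolean Functions* (CUP 2014), §1.4 (Parseval, here the landed
`sum_W_sq`). Everything below is proved from Mathlib and the tree; axioms are the standard three.
-/

set_option linter.dupNamespace false -- D-0017: single-problem summit ⇒ `QuantumAdvantage.QuantumAdvantage` by design

noncomputable section

namespace Summit.QuantumAdvantage.QuantumAdvantage.Theorems.CubicForrelation.NearExactIsExact

open Finset
open Literature.Computability.QuantumComplexity
open Literature.Computability.QuantumComplexity.DerivativeWalsh (W sum_W_sq)
open Literature.Computability.QuantumComplexity.BuzetChailloux (signOf_sq)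

/-- The pointwise key inequality at the bent level: for an integer `u`, `2|u| ≤ u² + [u odd]`. If `u` is odd this is
`(|u| − 1)² ≥ 0`; if `u` is even then `|u| − 1` is odd, hence non-zero, so `(|u| − 1)² ≥ 1`. [folklore] -/
theorem lb_pointwise (u : ℤ) : 2 * |(u : ℝ)| ≤ (u : ℝ) ^ 2 + (if Odd u then 1 else 0) := by
  split_ifs with hu
  · nlinarith [sq_nonneg (|(u : ℝ)| - 1), sq_abs (u : ℝ)]
  · have hev : Even |u| := Int.not_odd_iff_even.1 fun h => hu (odd_abs.1 h)
    have hodd : Odd (|u| - 1) := hev.sub_odd odd_one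
    have hne : |u| - 1 ≠ 0 := by
      rintro h
      rw [h] at hodd
      exact (Int.not_odd_iff_even.2 (by decide)) hodd
    have h1 : (1 : ℤ) ≤ (|u| - 1) ^ 2 := (one_le_sq_iff_one_le_abs _).2 (Int.one_le_abs hne)
    have h2 : (2 : ℤ) * |u| ≤ u ^ 2 := by nlinarith [sq_abs u, h1]
    have h3 : ((2 * |u| : ℤ) : ℝ) ≤ ((u ^ 2 : ℤ) : ℝ) := by exact_mod_cast h2
    push_cast at h3
    simpa using h3

/-- **LB2 — the bent level of the 2-adic Walsh tower** (no degree hypothesis on `g`). On `m + m` bits: if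
`W_g(x) = 2^m · u(x)` (`u(x) ∈ ℤ`) for every `x` and the parity `x ↦ [u(x) odd]` has degree `≤ d`, then either
`W_g(x)² = 2^{m+m}` for all `x` (`g` is bent), or `Σ_x |W_g(x)| ≤ 2^{3m} · (1 − (1/2)^{d+1})`.
Proof: `Σ_x u(x)² = 2^{m+m}` (Parseval, `sum_W_sq`). If all `u(x)` are odd, all `u(x)² ≥ 1`, hence all `= 1`.
Otherwise `x ↦ [u(x) even]` is non-zero of degree `≤ d` (`bb_isDegLeFun_bxor` with the constant `true`), so
`#{u even} ≥ 2^{m+m−d}` (`bb_rmWeight_holds`); pointwise `2|u| ≤ u² + [u odd]` (`lb_pointwise`); sum and use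
`Σ|W| = 2^m Σ|u|`. -/
theorem stub_levelBent :
    ∀ (m d : ℕ) (g : (Fin (m + m) → Bool) → Bool) (u : (Fin (m + m) → Bool) → ℤ),
      (∀ x, W (fun y => signOf (g y)) x = (2 : ℝ) ^ m * (u x : ℝ)) →
      IsDegLeFun d (fun x => decide (Odd (u x))) →
      (∀ x, W (fun y => signOf (g y)) x ^ 2 = (2 : ℝ) ^ (m + m)) ∨
        ∑ x, |W (fun y => signOf (g y)) x| ≤ (2 : ℝ) ^ (3 * m) * (1 - (1 / 2) ^ (d + 1)) := by
  intro m d g u hu hdeg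
  -- the number of points
  have hcard : (univ : Finset (Fin (m + m) → Bool)).card = 2 ^ (m + m) := by
    rw [card_univ, Fintype.card_fun, Fintype.card_bool, Fintype.card_fin]
  have e1 : ((2 : ℝ) ^ m) ^ 2 = (2 : ℝ) ^ (m + m) := by rw [sq, ← pow_add]
  -- Parseval: `Σ u² = 2^{m+m}`
  have hpars : ∑ x, (u x : ℝ) ^ 2 = (2 : ℝ) ^ (m + m) := by
    have h1 := sum_W_sq (fun y => signOf (g y))
    simp only [signOf_sq, sum_const, hcard, nsmul_eq_mul, mul_one, Nat.cast_pow, Nat.cast_ofNat] at h1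
    have h2 : ∑ x, W (fun y => signOf (g y)) x ^ 2 = (2 : ℝ) ^ (m + m) * ∑ x, (u x : ℝ) ^ 2 := by
      rw [mul_sum]
      exact sum_congr rfl fun x _ => by rw [hu x, mul_pow, e1]
    rw [h2] at h1
    exact mul_left_cancel₀ (by positivity) h1
  by_cases hall : ∀ x, Odd (u x)
  · -- CASE 1: every `u(x)` is odd ⇒ every `u(x)² = 1` ⇒ bent
    left
    have hparsZ : ∑ x, u x ^ 2 = (2 : ℤ) ^ (m + m) := by exact_mod_cast hpars
    have hle : ∀ x ∈ (univ : Finset (Fin (m + m) → Bool)), (1 : ℤ) ≤ u x ^ 2 := by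
      intro x _
      have hne : u x ≠ 0 := by
        intro h
        have hx := hall x
        rw [h] at hx
        exact (Int.not_odd_iff_even.2 (by decide)) hx
      exact (one_le_sq_iff_one_le_abs _).2 (Int.one_le_abs hne)
    have hone : ∑ _x : Fin (m + m) → Bool, (1 : ℤ) = (2 : ℤ) ^ (m + m) := by
      rw [sum_const, hcard, nsmul_eq_mul, mul_one]
      push_cast
      rfl
    have heq : ∀ x ∈ (univ : Finset (Fin (m + m) → Bool)), (1 : ℤ) = u x ^ 2 :=
      (sum_eq_sum_iff_of_le hle).1 (by rw [hone, hparsZ])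
    intro x
    have hx : (u x : ℝ) ^ 2 = 1 := by exact_mod_cast (heq x (mem_univ x)).symm
    rw [hu x, mul_pow, hx, mul_one, e1]
  · -- CASE 2: some `u(x₀)` is even ⇒ the capacity bound
    right
    obtain ⟨x₀, hx₀⟩ := not_forall.1 hall
    -- (a) the negated parity has degree `≤ d`
    have he : IsDegLeFun d (fun x => (decide (Odd (u x)) ^^ true)) :=
      bb_isDegLeFun_bxor hdeg (isDegLeFun_const d true)
    -- (b) its Reed–Muller weight: `2^{m+m} ≤ 2^d · #{u even}`
    have hrm : (2 : ℝ) ^ (m + m) ≤ (2 : ℝ) ^ d * ((univ.filter fun x => ¬ Odd (u x)).card : ℝ) := by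
      have h1 := bb_rmWeight_holds (m + m) d (fun x => (decide (Odd (u x)) ^^ true)) he
        ⟨x₀, by simpa using hx₀⟩
      have h2 : (univ.filter fun x => (decide (Odd (u x)) ^^ true) = true) =
          univ.filter fun x => ¬ Odd (u x) :=
        filter_congr fun x _ => by simp
      rw [h2] at h1
      exact_mod_cast h1
    -- (c) `#{u odd} + #{u even} = 2^{m+m}`
    have hcnt : ((univ.filter fun x => Odd (u x)).card : ℝ) +
        ((univ.filter fun x => ¬ Odd (u x)).card : ℝ) = (2 : ℝ) ^ (m + m) := by
      have h := card_filter_add_card_filter_not (s := (univ : Finset (Fin (m + m) → Bool)))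
        (fun x => Odd (u x))
      rw [hcard] at h
      exact_mod_cast h
    -- (d) the pointwise inequality, summed: `2 Σ|u| ≤ Σ u² + #{u odd}`
    have hpt : 2 * ∑ x, |(u x : ℝ)| ≤
        ∑ x, (u x : ℝ) ^ 2 + ((univ.filter fun x => Odd (u x)).card : ℝ) := by
      have hboole : ∑ x : Fin (m + m) → Bool, (if Odd (u x) then (1 : ℝ) else 0) =
          ((univ.filter fun x => Odd (u x)).card : ℝ) :=
        sum_boole _ _
      calc 2 * ∑ x, |(u x : ℝ)| = ∑ x, 2 * |(u x : ℝ)| := by rw [mul_sum]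
        _ ≤ ∑ x, ((u x : ℝ) ^ 2 + (if Odd (u x) then 1 else 0)) :=
          sum_le_sum fun x _ => lb_pointwise (u x)
        _ = _ := by rw [sum_add_distrib, hboole]
    -- (e) `Σ|W| = 2^m Σ|u|`
    have hsumW : ∑ x, |W (fun y => signOf (g y)) x| = (2 : ℝ) ^ m * ∑ x, |(u x : ℝ)| := by
      rw [mul_sum]
      refine sum_congr rfl fun x _ => ?_
      rw [hu x, abs_mul, abs_of_pos (by positivity)]
    -- exponent bookkeeping: `A = 2^m`, `R = 2^{d+1}`
    have e3 : (2 : ℝ) ^ (3 * m) = ((2 : ℝ) ^ m) ^ 3 := by rw [mul_comm, pow_mul]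
    rw [hsumW, e3, one_div_pow]
    rw [hpars] at hpt
    rw [← e1] at hpt hrm hcnt
    have hA0 : (0 : ℝ) < (2 : ℝ) ^ m := by positivity
    have hR0 : (0 : ℝ) < (2 : ℝ) ^ (d + 1) := by positivity
    have hrm2 : 2 * ((2 : ℝ) ^ m) ^ 2 ≤ (2 : ℝ) ^ (d + 1) * ((univ.filter fun x => ¬ Odd (u x)).card : ℝ) := by
      rw [pow_succ (2 : ℝ) d]
      linarith [hrm]
    set A : ℝ := (2 : ℝ) ^ m
    set R : ℝ := (2 : ℝ) ^ (d + 1)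
    set S : ℝ := ∑ x, |(u x : ℝ)|
    set NO : ℝ := ((univ.filter fun x => Odd (u x)).card : ℝ)
    set NE : ℝ := ((univ.filter fun x => ¬ Odd (u x)).card : ℝ)
    have h5 : 2 * S + NE ≤ 2 * A ^ 2 := by linarith [hpt, hcnt]
    have h6 : A * R * (2 * S + NE) ≤ A * R * (2 * A ^ 2) :=
      mul_le_mul_of_nonneg_left h5 (by positivity)
    have h7 : A * (2 * A ^ 2) ≤ A * (R * NE) := mul_le_mul_of_nonneg_left hrm2 hA0.le
    have key : A * S * R ≤ A ^ 3 * R - A ^ 3 := by linarith [h6, h7]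
    have hgoal : A ^ 3 * (1 - 1 / R) = (A ^ 3 * R - A ^ 3) / R := by
      field_simp
    rw [hgoal, le_div_iff₀ hR0]
    exact key

end Summit.QuantumAdvantage.QuantumAdvantage.Theorems.CubicForrelation.NearExactIsExact
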